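import Summits.PneNP.PneNP.Theorems.NegLimitedHalfWindowDefs
import Summits.PneNP.PneNP.Theorems.NegLimitedAmplifiedWindowSlicesVerifier
import Literature.Computability.Complexity.CodeFPRat
import Literature.Computability.Cryptography.RejectionSamplerArithFP
import Literature.Computability.Complexity.SparseSetsUpwardSeparationTally
import Mathlib
import HarnessLib

/-!
# Half window — stub S′, part 1: the certificate verifier of the `TRIBES ∘ RM3 ∘ CLIQUE` language
(cell pnp-ideate, rung F-N1/p3, ROUND-13; line `half-window` on item stmt-PneNP-19888, stub S′
`HalfSlicesNP`; card HOME/pnp-ideate-p3/r13/half-window.md; BLUEPRINT-R2.md §S′)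

The `NP` witness of the line is ONE language whose slice at length
`halfLen n kc r = 2^{pair r kc}·(2·hP·n² + 1)` (`hP = m·w·3^d`, `w = r⌊log₂ n⌋`, `m = mCal w`,
`d = 10(⌊log₂ w⌋+1)`) is `TRIBES_{w,m} ∘ RM3_d` of the `hP` clique indicators `CLIQUE(n,kc)` of the `hP`
consecutive `n × n` upper-triangle bit matrices of the input.  This file is the VERIFIER as a mathematical
function `verdict : {0,1}* × {0,1}* → Bool` on (input, certificate), with the elementary unfolding lemmas
and the polynomial-time computability of its PARAMETER CHECKS (typed `CodeFP` algebra):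

* the certificate `y = ⟨1ⁿ, ⟨1^kc, ⟨1^r, ⟨1^L, ⟨1^Lw, ⟨1^P, ⟨1^w, ⟨1^m, ⟨1^d, T⟩⟩⟩⟩⟩⟩⟩⟩⟩` names the parameters in
  unary (fields `pN … pD`, read back with the total pair projections, so EVERY string parses) and a mark string
  `T` (`T[β·n + v]`: vertex `v` is marked in block `β`);
* `checks`: `3 ≤ kc < n`, `1 ≤ r`, `2^L ≤ n < 2^{L+1}`, `w = r·L`, `2^{Lw} ≤ w < 2^{Lw+1}`, `P = pair r kc`,
  `m ≤ Σ_{j=1}^{w} 2^{w−j}/j < m + 1` (exact rational arithmetic, `mSumQ`, `CodeFP.ratLe/ratLt`; so `m = mCal w`),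
  `d = 10(Lw+1)` and
  `|u| = 2^P·(2·m·w·3^d·n² + 1)` (every power has a certificate field as exponent, so no type-level term
  `3^{10(Lw+1)}` is ever unfolded by the elaborator);
* `rmVal t`: the `d` stride rounds of the door's verifier (`SlicesNP.rounds`, p478375) on the `3^d` block bits
  `SlicesNP.blockBit` of the blocks `s + 3^d·t`; `tribesVal = ∃ j < m, ∀ i < w, rmVal (i + w·j)`;
* `verdict = checks ∧ tribesVal`; `codeFP_checks`.
Part 2 (`…SlicesLang`) proves `verdict ∈ FP` and defines the language; part 3/4 identify the slices.

References: S. Arora, B. Barak, *Computational Complexity* (2009), §1.3, §2.1 [AroraBarakCC2009].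

HONEST FRAMING: verifier plumbing for stub S′ of an OPEN line; FRONTIER rung F-N1 — nothing here bears on
P vs NP.
-/

set_option linter.dupNamespace false -- `Summit.PneNP.PneNP.…`: summit = sub-problem name (D-0017 single-conjunct layout)

namespace Summit.PneNP.PneNP.Theorems.NegLimitedHalfWindow.HalfSlices

open Literature.Computability.Complexity Literature.Computability.Complexity.Brick
  Literature.Computability.Complexity.CodeFP _root_.Computability Polynomial
open Summit.PneNP.PneNP.Theorems.NegLimitedAmplifiedWindow.SlicesNP (blockBit rounds round)
open Literature.Algebra.EuclideanLattices (encodeRat)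

/-! ### The verifier as a mathematical function -/

/-- Iterated second pair projection `sndF^[i]` (IRREDUCIBLE: the elaborator must never unfold nine nested
pair projections — doing so is exponentially slow). -/
irreducible_def tailF (i : ℕ) (y : List Bool) : List Bool := sndF^[i] y

/-- The `i`-th unary field of the certificate. -/
def fieldU (i : ℕ) (y : List Bool) : ℕ := (fstF (tailF i y)).length

/-- `n`. -/
def pN (y : List Bool) : ℕ := fieldU 0 y
/-- `kc`. -/
def pK (y : List Bool) : ℕ := fieldU 1 y
/-- `r`. -/
def pR (y : List Bool) : ℕ := fieldU 2 y
/-- `L` (claimed `⌊log₂ n⌋`). -/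
def pL (y : List Bool) : ℕ := fieldU 3 y
/-- `Lw` (claimed `⌊log₂ w⌋`). -/
def pLw (y : List Bool) : ℕ := fieldU 4 y
/-- `P` (claimed `pair r kc`). -/
def pP (y : List Bool) : ℕ := fieldU 5 y
/-- `w` (claimed `r·⌊log₂ n⌋`). -/
def pW (y : List Bool) : ℕ := fieldU 6 y
/-- `m` (claimed `mCal w`). -/
def pM (y : List Bool) : ℕ := fieldU 7 y
/-- `d` (claimed `10·(Lw + 1)`). -/
def pD (y : List Bool) : ℕ := fieldU 8 y
/-- The mark string `T`. -/
def pT (y : List Bool) : List Bool := tailF 9 y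

/-- The calibration sum `Σ_{j=1}^{w} 2^{w−j}/j` as a list sum (exact rationals). -/
def mSumQ (w : ℕ) : ℚ :=
  ((List.range w).map fun j => (((2 ^ (w - (j + 1)) : ℕ) : ℤ) : ℚ) / (((j + 1 : ℕ)) : ℚ)).sum

/-- The parameter checks. -/
def checks (u y : List Bool) : Bool :=
  decide (3 ≤ pK y) && (decide (pK y < pN y) && (decide (1 ≤ pR y) &&
    (decide (2 ^ pL y ≤ pN y) && (decide (pN y < 2 ^ (pL y + 1)) && (decide (pW y = pR y * pL y) &&
    (decide (2 ^ pLw y ≤ pW y) && (decide (pW y < 2 ^ (pLw y + 1)) && (decide (pP y = Nat.pair (pR y) (pK y)) &&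
    (decide ((pM y : ℚ) ≤ mSumQ (pW y)) && (decide (mSumQ (pW y) < (pM y : ℚ) + 1) &&
    (decide (pD y = 10 * (pLw y + 1)) &&
    decide (u.length = 2 ^ pP y * (2 * (pM y * pW y * 3 ^ pD y * (pN y * pN y)) + 1)))))))))))))

/-- The level string of the RM3 instance `t`: the block bits of the blocks `s + 3^d·t`, `s < 3^d`
(capped at `|u|`; `= 3^d` under `checks`). -/
def levStr (u y : List Bool) (t : ℕ) : List Bool :=
  (List.range (min (3 ^ pD y) u.length)).map fun s => blockBit u (pT y) (pN y) (pK y) (s + 3 ^ pD y * t)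

/-- The value of the RM3 instance `t` (the door's evaluation rounds on its level string). -/
def rmVal (u y : List Bool) (t : ℕ) : Bool := (rounds (pD y) (levStr u y t)).getD 0 false

/-- `TRIBES_{w,m}` of the RM3 values: some tribe `j < m` has all its `w` members `i + w·j` accepted. -/
def tribesVal (u y : List Bool) : Bool :=
  (List.range (pM y)).any fun j => (List.range (pW y)).all fun i => rmVal u y (i + pW y * j)

/-- **The verdict** on (input, certificate). -/
def verdict (p : List Bool × List Bool) : Bool := checks p.1 p.2 && tribesVal p.1 p.2

/-! ### Elementary facts -/

/-- `tailF (i+1) y = tailF i (sndF y)`. -/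
theorem tailF_succ (i : ℕ) (y : List Bool) : tailF (i + 1) y = tailF i (sndF y) := by
  simp only [tailF_def, Function.iterate_succ_apply]

/-- `tailF (i+1) y = sndF (tailF i y)`. -/
theorem tailF_succ' (i : ℕ) (y : List Bool) : tailF (i + 1) y = sndF (tailF i y) := by
  simp only [tailF_def, Function.iterate_succ_apply']

/-- `tailF 0 = id`. -/
theorem tailF_zero (y : List Bool) : tailF 0 y = y := by
  simp only [tailF_def, Function.iterate_zero, id]

/-- The parameter checks, unfolded. -/
theorem checks_eq_true_iff {u y : List Bool} :
    checks u y = true ↔ 3 ≤ pK y ∧ pK y < pN y ∧ 1 ≤ pR y ∧ 2 ^ pL y ≤ pN y ∧ pN y < 2 ^ (pL y + 1) ∧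
      pW y = pR y * pL y ∧ 2 ^ pLw y ≤ pW y ∧ pW y < 2 ^ (pLw y + 1) ∧ pP y = Nat.pair (pR y) (pK y) ∧
      (pM y : ℚ) ≤ mSumQ (pW y) ∧ mSumQ (pW y) < (pM y : ℚ) + 1 ∧ pD y = 10 * (pLw y + 1) ∧
      u.length = 2 ^ pP y * (2 * (pM y * pW y * 3 ^ pD y * (pN y * pN y)) + 1) := by
  simp only [checks, Bool.and_eq_true, decide_eq_true_iff]

/-- The verdict, unfolded. -/
theorem verdict_eq_true_iff {u y : List Bool} :
    verdict (u, y) = true ↔ checks u y = true ∧ tribesVal u y = true := by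
  simp only [verdict, Bool.and_eq_true]

/-- `tribesVal`, unfolded. -/
theorem tribesVal_eq_true_iff {u y : List Bool} :
    tribesVal u y = true ↔ ∃ j, j < pM y ∧ ∀ i, i < pW y → rmVal u y (i + pW y * j) = true := by
  simp only [tribesVal, List.any_eq_true, List.mem_range, List.all_eq_true]

/-- The calibration sum is the `Finset` sum of the tree's `mCal`. -/
theorem mSumQ_eq (w : ℕ) : mSumQ w = ∑ j ∈ Finset.Icc 1 w, (2 : ℚ) ^ (w - j) / (j : ℚ) := by
  have hsum : ∀ (f : ℕ → ℚ) (m : ℕ), ((List.range m).map f).sum = ∑ i ∈ Finset.range m, f i := by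
    intro f m
    induction m with
    | zero => simp
    | succ m ih => rw [List.range_succ, List.map_append, List.sum_append, ih, Finset.sum_range_succ]; simp
  unfold mSumQ
  rw [hsum]
  have hIcc : Finset.Icc 1 w = (Finset.range w).image (· + 1) := by
    ext j
    simp only [Finset.mem_Icc, Finset.mem_image, Finset.mem_range]
    constructor
    · intro h; exact ⟨j - 1, by omega, by omega⟩
    · rintro ⟨i, hi, rfl⟩; omega
  rw [hIcc, Finset.sum_image fun a _ b _ h => by simpa using h]
  refine Finset.sum_congr rfl fun j _ => ?_
  push_cast
  ring_nf

/-- Under the two rational inequalities of `checks`, `m = mCal w`. -/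
theorem eq_mCal_of_bounds {m w : ℕ} (h1 : (m : ℚ) ≤ mSumQ w) (h2 : mSumQ w < (m : ℚ) + 1) : m = mCal w := by
  rw [mSumQ_eq] at h1 h2
  unfold mCal
  symm
  rw [Nat.floor_eq_iff (le_trans (by positivity) h1)]
  exact ⟨h1, h2⟩

/-- The honest certificate. -/
def cert (n kc r L Lw P w m d : ℕ) (T : List Bool) : List Bool :=
  boolPair (List.replicate n true) (boolPair (List.replicate kc true) (boolPair (List.replicate r true)
    (boolPair (List.replicate L true) (boolPair (List.replicate Lw true) (boolPair (List.replicate P true)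
      (boolPair (List.replicate w true) (boolPair (List.replicate m true)
        (boolPair (List.replicate d true) T))))))))

section Cert
variable (n kc r L Lw P w m d : ℕ) (T : List Bool)

/-- Its `n`. -/
@[simp] theorem pN_cert : pN (cert n kc r L Lw P w m d T) = n := by simp [pN, fieldU, tailF_zero, cert]
/-- Its `kc`. -/
@[simp] theorem pK_cert : pK (cert n kc r L Lw P w m d T) = kc := by simp [pK, fieldU, tailF_succ', tailF_zero, cert]
/-- Its `r`. -/
@[simp] theorem pR_cert : pR (cert n kc r L Lw P w m d T) = r := by simp [pR, fieldU, tailF_succ', tailF_zero, cert]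
/-- Its `L`. -/
@[simp] theorem pL_cert : pL (cert n kc r L Lw P w m d T) = L := by simp [pL, fieldU, tailF_succ', tailF_zero, cert]
/-- Its `Lw`. -/
@[simp] theorem pLw_cert : pLw (cert n kc r L Lw P w m d T) = Lw := by simp [pLw, fieldU, tailF_succ', tailF_zero, cert]
/-- Its `P`. -/
@[simp] theorem pP_cert : pP (cert n kc r L Lw P w m d T) = P := by simp [pP, fieldU, tailF_succ', tailF_zero, cert]
/-- Its `w`. -/
@[simp] theorem pW_cert : pW (cert n kc r L Lw P w m d T) = w := by simp [pW, fieldU, tailF_succ', tailF_zero, cert]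
/-- Its `m`. -/
@[simp] theorem pM_cert : pM (cert n kc r L Lw P w m d T) = m := by simp [pM, fieldU, tailF_succ', tailF_zero, cert]
/-- Its `d`. -/
@[simp] theorem pD_cert : pD (cert n kc r L Lw P w m d T) = d := by simp [pD, fieldU, tailF_succ', tailF_zero, cert]
/-- Its mark string. -/
@[simp] theorem pT_cert : pT (cert n kc r L Lw P w m d T) = T := by simp [pT, tailF_succ', tailF_zero, cert]

/-- Its length. -/
theorem length_cert : (cert n kc r L Lw P w m d T).length =
    2 * (n + kc + r + L + Lw + P + w + m + d) + 18 + T.length := by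
  simp only [cert, length_boolPair, List.length_replicate]; ring

end Cert

/-! ### Polynomial time on codes: accessors and checks -/

/-- The code of (input, certificate): the pair of the two raw strings. -/
abbrev E : List Bool × List Bool → List Bool := pairE strE strE

/-- `sndF^[i]` on codes. -/
theorem codeFP_tailF : ∀ i : ℕ, CodeFP strE strE (tailF i)
  | 0 => (CodeFP.id strE).congr fun y => (tailF_zero y).symm
  | i + 1 => by
    -- (the pair projections as `CodeFP strE strE` maps are `SumcheckIP.sndC` / `QuantumAdvantage.fstF_code`,
    -- inlined here rather than imported)
    have hs : CodeFP strE strE sndF := ⟨sndF, sndF_mem_FP, fun _ => rfl⟩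
    exact ((codeFP_tailF i).comp hs).congr fun y => (tailF_succ i y).symm

/-- The `i`-th field in binary. -/
theorem codeFP_fieldU (i : ℕ) : CodeFP strE natE (fieldU i) := by
  have hf : CodeFP strE strE fstF := ⟨fstF, fstF_mem_FP, fun _ => rfl⟩
  exact (strNatLength.comp (hf.comp (codeFP_tailF i))).congr fun _ => rfl

/-- The `i`-th field in unary. -/
theorem codeFP_fieldUu (i : ℕ) : CodeFP strE unE (fieldU i) := by
  have hf : CodeFP strE strE fstF := ⟨fstF, fstF_mem_FP, fun _ => rfl⟩
  exact (strLength.comp (hf.comp (codeFP_tailF i))).congr fun _ => rfl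

/-- `T`. -/
theorem codeFP_pT : CodeFP strE strE pT := (codeFP_tailF 9).congr fun _ => rfl

/-- `3^d` in binary (`d` is a certificate field, read in unary). -/
theorem codeFP_pow3 : CodeFP strE natE (fun y => 3 ^ pD y) :=
  (natPow.comp ((const strE 3).pair (codeFP_fieldUu 8))).congr fun _ => by rfl

/-- A natural number as a rational. -/
theorem codeFP_natToRat : CodeFP natE encodeRat (fun n : ℕ => (n : ℚ)) :=
  (ratOfIntNat.comp ((intOfNat).pair (const natE 1))).congr fun n => by
    show ((n : ℤ) : ℚ) / ((1 : ℕ) : ℚ) = (n : ℚ)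
    simp

/-- The calibration sum `mSumQ w` from `w` in unary. -/
theorem codeFP_mSumQ : CodeFP unE encodeRat mSumQ := by
  -- context `w` (unary), item `j` (binary)
  have hw : CodeFP (pairE unE natE) unE Prod.fst := fst _ _
  have hwb : CodeFP (pairE unE natE) natE Prod.fst := natOfUn.comp hw
  have hj : CodeFP (pairE unE natE) natE Prod.snd := snd _ _
  have hj1 : CodeFP (pairE unE natE) natE (fun q => q.2 + 1) := natAdd.comp (hj.pair (const _ 1))
  have hexp : CodeFP (pairE unE natE) unE (fun q => min (q.1 - (q.2 + 1)) q.1) :=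
    unOfNatMin.comp (hw.pair (natSub.comp (hwb.pair hj1)))
  have hpow : CodeFP (pairE unE natE) natE (fun q => 2 ^ (q.1 - (q.2 + 1))) :=
    (natPow.comp ((const _ 2).pair hexp)).congr fun q => by
      show 2 ^ min (q.1 - (q.2 + 1)) q.1 = 2 ^ (q.1 - (q.2 + 1))
      rw [min_eq_left (Nat.sub_le q.1 (q.2 + 1))]
  have hint : CodeFP (pairE unE natE) intE (fun q => ((2 ^ (q.1 - (q.2 + 1)) : ℕ) : ℤ)) :=
    intOfNat.comp hpow
  have hterm : CodeFP (pairE unE natE) encodeRat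
      (fun q => (((2 ^ (q.1 - (q.2 + 1)) : ℕ) : ℤ) : ℚ) / (((q.2 + 1 : ℕ)) : ℚ)) :=
    (ratOfIntNat.comp (hint.pair hj1)).congr fun _ => by rfl
  exact (ratSum.comp ((map hterm).comp ((CodeFP.id unE).pair urange))).congr fun _ => by rfl

/-- The parameter checks are polynomial time. -/
theorem codeFP_checks : CodeFP E bitE (fun p => checks p.1 p.2) := by
  have hy : CodeFP E strE Prod.snd := snd _ _
  have hn : CodeFP E natE (fun p => pN p.2) := (codeFP_fieldU 0).comp hy
  have hk : CodeFP E natE (fun p => pK p.2) := (codeFP_fieldU 1).comp hy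
  have hr : CodeFP E natE (fun p => pR p.2) := (codeFP_fieldU 2).comp hy
  have hL : CodeFP E natE (fun p => pL p.2) := (codeFP_fieldU 3).comp hy
  have hLu : CodeFP E unE (fun p => pL p.2) := (codeFP_fieldUu 3).comp hy
  have hLw : CodeFP E natE (fun p => pLw p.2) := (codeFP_fieldU 4).comp hy
  have hLwu : CodeFP E unE (fun p => pLw p.2) := (codeFP_fieldUu 4).comp hy
  have hP : CodeFP E natE (fun p => pP p.2) := (codeFP_fieldU 5).comp hy
  have hPu : CodeFP E unE (fun p => pP p.2) := (codeFP_fieldUu 5).comp hy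
  have hW : CodeFP E natE (fun p => pW p.2) := (codeFP_fieldU 6).comp hy
  have hWu : CodeFP E unE (fun p => pW p.2) := (codeFP_fieldUu 6).comp hy
  have hM : CodeFP E natE (fun p => pM p.2) := (codeFP_fieldU 7).comp hy
  have hD : CodeFP E natE (fun p => pD p.2) := (codeFP_fieldU 8).comp hy
  have h3d : CodeFP E natE (fun p => 3 ^ pD p.2) := codeFP_pow3.comp hy
  have h2L : CodeFP E natE (fun p => 2 ^ pL p.2) := (natPow.comp ((const E 2).pair hLu)).congr fun _ => by rfl
  have h2L1 : CodeFP E natE (fun p => 2 ^ (pL p.2 + 1)) :=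
    (natPow.comp ((const E 2).pair (unSucc.comp hLu))).congr fun _ => by rfl
  have h2Lw : CodeFP E natE (fun p => 2 ^ pLw p.2) := (natPow.comp ((const E 2).pair hLwu)).congr fun _ => by rfl
  have h2Lw1 : CodeFP E natE (fun p => 2 ^ (pLw p.2 + 1)) :=
    (natPow.comp ((const E 2).pair (unSucc.comp hLwu))).congr fun _ => by rfl
  have h2P : CodeFP E natE (fun p => 2 ^ pP p.2) := (natPow.comp ((const E 2).pair hPu)).congr fun _ => by rfl
  have hS : CodeFP E encodeRat (fun p => mSumQ (pW p.2)) := (codeFP_mSumQ.comp hWu).congr fun _ => by rfl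
  have hMq : CodeFP E encodeRat (fun p => (pM p.2 : ℚ)) := (codeFP_natToRat.comp hM).congr fun _ => by rfl
  have hM1q : CodeFP E encodeRat (fun p => ((pM p.2 : ℚ) + 1)) :=
    (codeFP_natToRat.comp (natAdd.comp (hM.pair (const E 1)))).congr fun p => by push_cast; rfl
  have c1 : CodeFP E bitE (fun p => decide (3 ≤ pK p.2)) :=
    (natLe.comp ((const E 3).pair hk)).congr fun _ => by rfl
  have c2 : CodeFP E bitE (fun p => decide (pK p.2 < pN p.2)) :=
    (natLt.comp (hk.pair hn)).congr fun _ => by rfl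
  have c3 : CodeFP E bitE (fun p => decide (1 ≤ pR p.2)) :=
    (natLe.comp ((const E 1).pair hr)).congr fun _ => by rfl
  have c4 : CodeFP E bitE (fun p => decide (2 ^ pL p.2 ≤ pN p.2)) :=
    (natLe.comp (h2L.pair hn)).congr fun _ => by rfl
  have c5 : CodeFP E bitE (fun p => decide (pN p.2 < 2 ^ (pL p.2 + 1))) :=
    (natLt.comp (hn.pair h2L1)).congr fun _ => by rfl
  have c6 : CodeFP E bitE (fun p => decide (pW p.2 = pR p.2 * pL p.2)) :=
    (natEq.comp (hW.pair (natMul.comp (hr.pair hL)))).congr fun _ => by rfl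
  have c7 : CodeFP E bitE (fun p => decide (2 ^ pLw p.2 ≤ pW p.2)) :=
    (natLe.comp (h2Lw.pair hW)).congr fun _ => by rfl
  have c8 : CodeFP E bitE (fun p => decide (pW p.2 < 2 ^ (pLw p.2 + 1))) :=
    (natLt.comp (hW.pair h2Lw1)).congr fun _ => by rfl
  have c9 : CodeFP E bitE (fun p => decide (pP p.2 = Nat.pair (pR p.2) (pK p.2))) :=
    (natEq.comp (hP.pair (SparseTally.natPairC.comp (hr.pair hk)))).congr fun _ => by rfl
  have c10 : CodeFP E bitE (fun p => decide ((pM p.2 : ℚ) ≤ mSumQ (pW p.2))) :=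
    (ratLe.comp (hMq.pair hS)).congr fun _ => by rfl
  have c11 : CodeFP E bitE (fun p => decide (mSumQ (pW p.2) < (pM p.2 : ℚ) + 1)) :=
    (ratLt.comp (hS.pair hM1q)).congr fun _ => by rfl
  have cD : CodeFP E bitE (fun p => decide (pD p.2 = 10 * (pLw p.2 + 1))) :=
    (natEq.comp (hD.pair (natMul.comp ((const E 10).pair
      (natAdd.comp (hLw.pair (const E 1))))))).congr fun _ => by rfl
  have c12 : CodeFP E bitE (fun p => decide (p.1.length =
      2 ^ pP p.2 * (2 * (pM p.2 * pW p.2 * 3 ^ pD p.2 * (pN p.2 * pN p.2)) + 1))) :=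
    (natEq.comp ((strNatLength.comp (fst _ _)).pair (natMul.comp (h2P.pair (natAdd.comp ((natMul.comp
      ((const E 2).pair (natMul.comp ((natMul.comp ((natMul.comp (hM.pair hW)).pair h3d)).pair
        (natMul.comp (hn.pair hn)))))).pair (const E 1))))))).congr fun _ => by rfl
  exact (c1.and (c2.and (c3.and (c4.and (c5.and (c6.and (c7.and (c8.and (c9.and (c10.and
    (c11.and (cD.and c12)))))))))))).congr fun _ => rfl

end Summit.PneNP.PneNP.Theorems.NegLimitedHalfWindow.HalfSlices
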